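import Literature.RingTheory.HilbertSamuel.ProjDirectrixLifts
import Literature.RingTheory.HilbertSamuel.TangentConeBaseChange
import Literature.RingTheory.HilbertSamuel.RegularCriterion
import Mathlib.RingTheory.RingHom.Flat
import HarnessLib

/-!
# «`ξ ∈ ℙ(Dir(𝒪))`» read through a local homomorphism: transport along isomorphisms of local rings
# (companion of `ProjDirectrixLifts.lean`; CJS 2020, Lemma 2.7 / Def. 2.18 / Def. 6.34 (i) with p. 107)

Topic: `Literature/RingTheory/HilbertSamuel`. Continuation of `ProjDirectrixLifts.lean` (the condition `ProjDirLiftsInto φ x`: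
every lift to `𝔪_A` of every linear form of the directrix space `𝒯(J_x)` goes to `(𝔪_A B)·𝔪_B` under `φ : A → B`). Here:

* `coe_directrixSpace_map_of_bijective` — **`𝒯(I · k'[X]) = κ(𝒯(I))`** for an isomorphism of fields `κ : k ≅ k'`
  (CJS Lemma 2.7: the directrix space is the least directing subspace; `map κ` matches the directing subspaces of `I`
  and of `I · k'[X]`, tree `Directs.map_field`);
* **`projDirLiftsInto_ringEquiv_iff`** — for isomorphisms of local rings `α : A ≅ A'`, `β : B ≅ B'` with `φ' ∘ α = β ∘ φ`,
  `ProjDirLiftsInto φ' (α ∘ x) ↔ ProjDirLiftsInto φ x`: tangent cone ideals (`tangentConeIdeal_eq_map`, CJS Lemma 2.27 (1)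
  for the quasi-étale `α`), directrix spaces and lifts correspond under `α`.

With `projDirLiftsInto_iff_of_minimal` this makes «`ξ ∈ ℙ(Dir_x(X))`» (the tree's `IsOnProjDirectrix`, CJS Def. 6.34 (i))
a property of the local homomorphism `𝒪_{X,x} → 𝒪_{X₁,ξ}` up to isomorphism — what reading `ℙ(Dir)` on a localised
tower of blow-ups needs (CJS p. 107 «the claims … depend only on the localization `X_x = Spec(𝒪_{X,x})`»).

## References

* V. Cossart, U. Jannsen, S. Saito, *Desingularization: Invariants and Strategy*, LNM 2270 (2020), Lemma 2.7,
  Def. 2.18, Lemma 2.27 (1), Def. 6.34 (i), p. 107. [CossartJannsenSaito2020]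
-/

noncomputable section

open IsLocalRing MvPolynomial Module
open Literature.AlgebraicGeometry.Resolution Literature.RingTheory.MvPolynomial

namespace Literature.RingTheory.HilbertSamuel

universe u v w

/-! ## The directrix space under an isomorphism of the ground field -/

section FieldIso

variable {k : Type v} {k' : Type w} [Field k] [Field k'] {n : ℕ}

/-- The image of a `k`-subspace of `k[X]` under `map κ`, `κ : k → k'` SURJECTIVE, is a `k'`-subspace of `k'[X]`.
[folklore] -/
private def imageSubmodule (κ : k →+* k') (hκ : Function.Surjective κ) (T : Submodule k (MvPolynomial (Fin n) k)) :
    Submodule k' (MvPolynomial (Fin n) k') where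
  carrier := MvPolynomial.map κ '' (T : Set (MvPolynomial (Fin n) k))
  zero_mem' := ⟨0, T.zero_mem, map_zero _⟩
  add_mem' := by
    rintro _ _ ⟨f, hf, rfl⟩ ⟨g, hg, rfl⟩
    exact ⟨f + g, T.add_mem hf hg, map_add _ _ _⟩
  smul_mem' := by
    rintro r _ ⟨f, hf, rfl⟩
    obtain ⟨s, rfl⟩ := hκ r
    refine ⟨s • f, T.smul_mem s hf, ?_⟩
    rw [smul_eq_C_mul, map_mul, map_C, smul_eq_C_mul]

/-- The span of the image is the image (it is already a subspace). [folklore] -/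
private theorem span_image_eq (κ : k →+* k') (hκ : Function.Surjective κ)
    (T : Submodule k (MvPolynomial (Fin n) k)) :
    (Submodule.span k' (MvPolynomial.map κ '' (T : Set (MvPolynomial (Fin n) k))) :
      Set (MvPolynomial (Fin n) k')) = MvPolynomial.map κ '' (T : Set (MvPolynomial (Fin n) k)) := by
  have : Submodule.span k' (MvPolynomial.map κ '' (T : Set (MvPolynomial (Fin n) k))) =
      imageSubmodule κ hκ T :=
    le_antisymm (Submodule.span_le.mpr fun f hf => hf) (fun f hf => Submodule.subset_span hf)
  rw [this]
  rfl

/-- One inclusion: `𝒯(I · k'[X]) ⊆ κ(𝒯(I))` for `κ : k → k'` surjective (hence bijective).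
[cite: CossartJannsenSaito2020, Lemma 2.7] -/
private theorem coe_directrixSpace_map_subset (κ : k →+* k') (hκ : Function.Surjective κ)
    (I : Ideal (MvPolynomial (Fin n) k)) :
    (directrixSpace (I.map (MvPolynomial.map κ)) : Set (MvPolynomial (Fin n) k')) ⊆
      MvPolynomial.map κ '' (directrixSpace I : Set (MvPolynomial (Fin n) k)) := by
  rw [← span_image_eq κ hκ]
  exact directrixSpace_le ((directs_directrixSpace I).map_field κ)

/-- **The directrix space is transported by isomorphisms of the ground field**: for a bijective `κ : k → k'`,
`𝒯(I · k'[X]) = κ(𝒯(I))` as sets of linear forms (CJS Lemma 2.7: `𝒯(I)` is the least directing subspace, and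
`map κ` matches directing subspaces of `I` and of `I · k'[X]`). [cite: CossartJannsenSaito2020, Lemma 2.7] -/
theorem coe_directrixSpace_map_of_bijective (κ : k →+* k') (hκ : Function.Bijective κ)
    (I : Ideal (MvPolynomial (Fin n) k)) :
    (directrixSpace (I.map (MvPolynomial.map κ)) : Set (MvPolynomial (Fin n) k')) =
      MvPolynomial.map κ '' (directrixSpace I : Set (MvPolynomial (Fin n) k)) := by
  refine (coe_directrixSpace_map_subset κ hκ.2 I).antisymm ?_
  -- apply the inclusion to `κ⁻¹` and `I · k'[X]`
  let κ' : k' →+* k := ((RingEquiv.ofBijective κ hκ).symm : k' ≃+* k)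
  have hκ'κ : κ'.comp κ = RingHom.id k := RingHom.ext fun a => (RingEquiv.ofBijective κ hκ).symm_apply_apply a
  have hκκ' : κ.comp κ' = RingHom.id k' := RingHom.ext fun a => (RingEquiv.ofBijective κ hκ).apply_symm_apply a
  have hψ'ψ : (MvPolynomial.map κ').comp (MvPolynomial.map κ) = RingHom.id (MvPolynomial (Fin n) k) := by
    refine RingHom.ext fun p => ?_
    rw [RingHom.comp_apply, MvPolynomial.map_map, hκ'κ, MvPolynomial.map_id, RingHom.id_apply]
  have hψψ' : ∀ p : MvPolynomial (Fin n) k', MvPolynomial.map κ (MvPolynomial.map κ' p) = p := fun p => by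
    rw [MvPolynomial.map_map, hκκ', MvPolynomial.map_id]
  have h := coe_directrixSpace_map_subset κ' (RingEquiv.ofBijective κ hκ).symm.surjective
    (I.map (MvPolynomial.map κ))
  rw [Ideal.map_map, hψ'ψ, Ideal.map_id] at h
  rintro _ ⟨f, hf, rfl⟩
  obtain ⟨g, hg, hgf⟩ := h hf
  rw [← hgf, hψψ']
  exact hg

end FieldIso

/-! ## Transport along isomorphisms of local rings -/

section Transport

variable {A : Type u} {A' : Type v} [CommRing A] [CommRing A'] [IsLocalRing A] [IsLocalRing A']
  [IsNoetherianRing A] [IsNoetherianRing A'] {B : Type w} {B' : Type w} [CommRing B] [CommRing B']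
  [IsLocalRing B] [IsLocalRing B'] (α : A ≃+* A') (β : B ≃+* B') {φ : A →+* B} {φ' : A' →+* B'}
  (hcomm : ∀ a, φ' (α a) = β (φ a)) {e : ℕ} {x : Fin e → A} (hx : Ideal.span (Set.range x) = maximalIdeal A)

omit [IsNoetherianRing A] [IsNoetherianRing A'] in
/-- The image of `𝔪_A` under an isomorphism of local rings is `𝔪_{A'}`. [folklore] -/
private theorem map_maximalIdeal_ringEquiv : (maximalIdeal A).map (α : A →+* A') = maximalIdeal A' := by
  have h : (maximalIdeal A').comap (α : A →+* A') = maximalIdeal A := by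
    ext a
    simp only [Ideal.mem_comap, mem_maximalIdeal, mem_nonunits_iff, RingHom.coe_coe]
    exact not_congr ⟨fun hu => by simpa using hu.map α.symm, fun hu => hu.map α⟩
  rw [← h, Ideal.map_comap_of_surjective (α : A →+* A') α.surjective]

include hx in
omit [IsNoetherianRing A] [IsNoetherianRing A'] in
/-- Generators of `𝔪_A` map to generators of `𝔪_{A'}` under an isomorphism (the case of CJS Lemma 2.27 (1) «`𝔪_x 𝒪' = 𝔪'`»
for an isomorphism). [cite: CossartJannsenSaito2020, Lemma 2.27 (1)] -/
theorem span_range_ringEquiv_comp : Ideal.span (Set.range (α ∘ x)) = maximalIdeal A' := by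
  rw [Set.range_comp, ← RingHom.coe_coe, ← Ideal.map_span, hx]
  exact map_maximalIdeal_ringEquiv α

include hcomm hx in
/-- **Transport of `ProjDirLiftsInto` along isomorphisms of local rings**: for `α : A ≅ A'`, `β : B ≅ B'` with
`φ' ∘ α = β ∘ φ`, the condition for `(φ, x)` is equivalent to the condition for `(φ', α ∘ x)` — tangent cone ideals,
directrix spaces (`coe_directrixSpace_map_of_bijective`) and lifts all correspond under `α`.
[cite: CossartJannsenSaito2020, Def. 2.18, Def. 6.34 (i)] -/
theorem projDirLiftsInto_ringEquiv_iff :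
    ProjDirLiftsInto φ' (α ∘ x) (span_range_ringEquiv_comp α hx) ↔ ProjDirLiftsInto φ x hx := by
  -- `α` as a flat algebra with `𝔪_A A' = 𝔪_{A'}`
  letI : Algebra A A' := (α : A →+* A').toAlgebra
  haveI : Module.Flat A A' :=
    RingHom.flat_algebraMap_iff.mp (RingHom.Flat.of_bijective (f := (α : A →+* A')) α.bijective)
  have hm : (maximalIdeal A).map (algebraMap A A') = maximalIdeal A' := map_maximalIdeal_ringEquiv α
  haveI : IsLocalHom (algebraMap A A') := isLocalHom_of_map_maximalIdeal_eq hm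
  -- the residue field map and its action on polynomials
  set κ : ResidueField A →+* ResidueField A' := ResidueField.map (algebraMap A A') with hκ
  have hκbij : Function.Bijective κ := (ResidueField.mapEquiv α).bijective
  -- tangent cone ideals and directrix spaces correspond
  have hJ : tangentConeIdeal (α ∘ x) (span_range_ringEquiv_comp α hx) =
      (tangentConeIdeal x hx).map (MvPolynomial.map κ) :=
    tangentConeIdeal_eq_map hm x hx
  have hT : (directrixSpace (tangentConeIdeal (α ∘ x) (span_range_ringEquiv_comp α hx)) :
      Set (MvPolynomial (Fin e) (ResidueField A'))) =
      MvPolynomial.map κ '' (directrixSpace (tangentConeIdeal x hx) : Set _) := by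
    rw [hJ]
    exact coe_directrixSpace_map_of_bijective κ hκbij _
  -- the target ideals correspond under `β`
  have hβm : (maximalIdeal B).map (β : B →+* B') = maximalIdeal B' := map_maximalIdeal_ringEquiv β
  have hP : ((maximalIdeal A).map φ * maximalIdeal B).map (β : B →+* B') =
      (maximalIdeal A').map φ' * maximalIdeal B' := by
    rw [Ideal.map_mul, hβm, Ideal.map_map, ← hm, Ideal.map_map]
    congr 1
    exact congrArg (fun g => Ideal.map g (maximalIdeal A)) (RingHom.ext fun a => (hcomm a).symm)
  have hmem : ∀ b : B, β b ∈ (maximalIdeal A').map φ' * maximalIdeal B' ↔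
      b ∈ (maximalIdeal A).map φ * maximalIdeal B := by
    intro b
    rw [← hP, Ideal.mem_map_iff_of_surjective (β : B →+* B') (by exact β.surjective)]
    constructor
    · rintro ⟨b', hb', hbb'⟩
      rw [RingHom.coe_coe] at hbb'
      rwa [← β.injective hbb']
    · exact fun hb => ⟨b, hb, RingHom.coe_coe β ▸ rfl⟩
  constructor
  · -- from `(φ', α ∘ x)` to `(φ, x)`
    intro h L hL c hc
    have hL' : MvPolynomial.map κ L ∈
        directrixSpace (tangentConeIdeal (α ∘ x) (span_range_ringEquiv_comp α hx)) := by
      rw [← SetLike.mem_coe, hT]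
      exact ⟨L, hL, rfl⟩
    have hc' : ∀ i, residue A' ((α ∘ c) i) = MvPolynomial.coeff (Finsupp.single i 1) (MvPolynomial.map κ L) := by
      intro i
      rw [MvPolynomial.coeff_map, ← hc i, hκ, ResidueField.map_residue]
      rfl
    have := h _ hL' (α ∘ c) hc'
    have hsum : (∑ i, (α ∘ c) i * (α ∘ x) i) = α (∑ i, c i * x i) := by
      simp [map_sum, map_mul]
    rw [hsum, hcomm] at this
    exact (hmem _).mp this
  · -- from `(φ, x)` to `(φ', α ∘ x)`
    intro h L' hL' c' hc'
    have hL'' : L' ∈ MvPolynomial.map κ '' (directrixSpace (tangentConeIdeal x hx) : Set _) := by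
      rw [← hT]
      exact hL'
    obtain ⟨L, hL, rfl⟩ := hL''
    -- `c' = α ∘ c`
    obtain ⟨c, rfl⟩ : ∃ c : Fin e → A, c' = α ∘ c :=
      ⟨fun i => α.symm (c' i), funext fun i => (α.apply_symm_apply (c' i)).symm⟩
    have hc : ∀ i, residue A (c i) = MvPolynomial.coeff (Finsupp.single i 1) L := by
      intro i
      have h1 := hc' i
      rw [MvPolynomial.coeff_map, Function.comp_apply] at h1
      have h2 : residue A' (α (c i)) = κ (residue A (c i)) := by
        rw [hκ, ResidueField.map_residue]; rfl
      exact hκbij.1 (h2.symm.trans h1)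
    have := h L hL c hc
    have hsum : (∑ i, (α ∘ c) i * (α ∘ x) i) = α (∑ i, c i * x i) := by
      simp [map_sum, map_mul]
    rw [hsum, hcomm]
    exact (hmem _).mpr this

end Transport

/-! ## Small transports used by the scheme-level readings -/

section Aux

variable {A : Type u} [CommRing A] [IsLocalRing A] {B : Type w} [CommRing B] [IsLocalRing B]

/-- A local homomorphism sends `𝔪_A` into `𝔪_B`. [folklore] -/
private theorem map_maximalIdeal_le_of_isLocalHom (φ : A →+* B) [IsLocalHom φ] :
    (maximalIdeal A).map φ ≤ maximalIdeal B :=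
  ((local_hom_TFAE φ).out 0 2).mp ‹_›

/-- `ProjDirLiftsInto` for a local homomorphism, «∃ a lift» form. [cite: CossartJannsenSaito2020, Def. 6.34 (i)] -/
theorem projDirLiftsInto_iff_exists_of_isLocalHom (φ : A →+* B) [IsLocalHom φ] {e : ℕ} {x : Fin e → A}
    (hx : Ideal.span (Set.range x) = maximalIdeal A) :
    ProjDirLiftsInto φ x hx ↔ ∀ L ∈ directrixSpace (tangentConeIdeal x hx), ∃ c : Fin e → A,
      (∀ i, residue A (c i) = MvPolynomial.coeff (Finsupp.single i 1) L) ∧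
        φ (∑ i, c i * x i) ∈ (maximalIdeal A).map φ * maximalIdeal B :=
  projDirLiftsInto_iff_exists hx (map_maximalIdeal_le_of_isLocalHom φ)

/-- Re-indexing the generators along `Fin.cast` does not change `ProjDirLiftsInto` (bookkeeping for comparing minimal
systems of generators indexed by `Fin (emb.dim A)` and `Fin (emb.dim A')`). [cite: CossartJannsenSaito2020, Def. 2.18] -/
theorem projDirLiftsInto_comp_cast_iff (φ : A →+* B) {e e' : ℕ} (h : e' = e) {x : Fin e → A}
    (hx : Ideal.span (Set.range x) = maximalIdeal A)
    (hx' : Ideal.span (Set.range (x ∘ Fin.cast h)) = maximalIdeal A) :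
    ProjDirLiftsInto φ (x ∘ Fin.cast h) hx' ↔ ProjDirLiftsInto φ x hx := by
  subst h
  exact Iff.rfl

/-- **Independence of the minimal system of generators, for a LOCAL homomorphism** (`projDirLiftsInto_iff_of_minimal`
with the inclusion `φ(𝔪_A) ⊆ 𝔪_B` supplied). [cite: CossartJannsenSaito2020, Lemma 2.7, Def. 2.18] -/
theorem projDirLiftsInto_iff_of_minimal_of_isLocalHom [IsNoetherianRing A] (φ : A →+* B) [IsLocalHom φ] {e : ℕ}
    {x x' : Fin e → A} (hx : Ideal.span (Set.range x) = maximalIdeal A)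
    (hx' : Ideal.span (Set.range x') = maximalIdeal A) (he : (maximalIdeal A).spanFinrank = e) :
    ProjDirLiftsInto φ x hx ↔ ProjDirLiftsInto φ x' hx' :=
  projDirLiftsInto_iff_of_minimal hx hx' he (map_maximalIdeal_le_of_isLocalHom φ)

/-- Isomorphic noetherian local rings have the same embedding dimension. [cite: CossartJannsenSaito2020, Lemma 2.27 (1)] -/
theorem spanFinrank_maximalIdeal_eq_of_ringEquiv {A' : Type v} [CommRing A'] [IsLocalRing A'] [IsNoetherianRing A]
    [IsNoetherianRing A'] (α : A ≃+* A') :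
    (maximalIdeal A').spanFinrank = (maximalIdeal A).spanFinrank := by
  letI : Algebra A A' := (α : A →+* A').toAlgebra
  haveI : Module.Flat A A' :=
    RingHom.flat_algebraMap_iff.mp (RingHom.Flat.of_bijective (f := (α : A →+* A')) α.bijective)
  have hm : (maximalIdeal A).map (algebraMap A A') = maximalIdeal A' := map_maximalIdeal_ringEquiv α
  rw [← hilbertFun_one_eq_spanFinrank, ← hilbertFun_one_eq_spanFinrank,
    hilbertFun_eq_of_flat_of_map_maximalIdeal_eq hm]

end Aux

end Literature.RingTheory.HilbertSamuel

end
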